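import Summits.QuantumAdvantage.QuantumAdvantage.Theorems.CubicForrelationNearExactIsExactCubicFormFibre
import Summits.QuantumAdvantage.QuantumAdvantage.Theorems.CubicForrelationNearExactIsExactCubicFormDicksonExact

/-!
# Crux `CubicForrelation.NearExactIsExact` (stmt-QuantumAdvantage-14043) — the COARSE MENU of a `T`-cell: `h ≥ 2 ⇒ wt ≥ 192`,
  `h ≥ 1 ⇒ wt ≥ 128` (cell lemma L-T, E1280-HANDPROOFS App. A.3, the `h`-part)

Certificate seat `b2b-cforr-cert` (gen 41).  HONEST FRAMING: kernel-checked assembly (standard axioms) of …CubicFormFibre (`tfb_fibre_formula`,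
(FIB)) and …CubicFormDicksonExact (`tce_dickson_exact`) on the eight fibres `Q_u` (`u ∈ 𝔽₂³`) of a cell with cubic form `T = y₀y₁y₂` on
`3 + 6` bits: if the common fibre form `β_FF` has a maximal frame of size `h`, then every fibre has `2#Q_u ∈ {64 − 2^{6−h}, 64, 64 + 2^{6−h}}`,
so `wt f = Σ_{u≠111} #Q_u + 64 − #Q_{111}` is `≥ 7·24 + 24 = 192` for `h ≥ 2` and `≥ 7·16 + 16 = 128` for `h ≥ 1` (A.3: `M(h ≥ 2, ·) ≥ 192`;
the `r̄`-refinements `M(0,1) ≥ 128`, `M(0,≥2) ≥ 192`, `M(1,0) ≥ 160`, `M(1,≥1) ≥ 192` are NOT in this file).  Nothing about `θ₁₂`;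
NOT summit progress.

* `tfm_T_menu`: the two bounds.

References: E1280-HANDPROOFS.md App. A.3; L. E. Dickson (1901).  Axioms: the standard three.
-/

set_option linter.dupNamespace false -- D-0017: single-problem summit ⇒ `QuantumAdvantage.QuantumAdvantage` by design

namespace Summit.QuantumAdvantage.QuantumAdvantage.Theorems.CubicForrelation.NearExactIsExact

open Finset
open Literature.Computability.QuantumComplexity.BuzetChailloux (bxor zeroVec allOnes)

/-- **Coarse menu of a `T`-cell.**  See the module docstring. [this work] -/
theorem tfm_T_menu (f : (Fin (3 + 6) → Bool) → Bool)
    (hT : ∀ u v w x : Fin (3 + 6) → Bool,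
      (((f x ^^ f (bxor x w)) ^^ (f (bxor x v) ^^ f (bxor (bxor x v) w))) ^^
          ((f (bxor x u) ^^ f (bxor (bxor x u) w)) ^^ (f (bxor (bxor x u) v) ^^ f (bxor (bxor (bxor x u) v) w)))) =
        ((((u (Fin.castAdd 6 0) && (v (Fin.castAdd 6 1) && w (Fin.castAdd 6 2))) ^^
              (u (Fin.castAdd 6 0) && (v (Fin.castAdd 6 2) && w (Fin.castAdd 6 1)))) ^^
            ((u (Fin.castAdd 6 1) && (v (Fin.castAdd 6 0) && w (Fin.castAdd 6 2))) ^^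
              (u (Fin.castAdd 6 1) && (v (Fin.castAdd 6 2) && w (Fin.castAdd 6 0))))) ^^
          ((u (Fin.castAdd 6 2) && (v (Fin.castAdd 6 0) && w (Fin.castAdd 6 1))) ^^
            (u (Fin.castAdd 6 2) && (v (Fin.castAdd 6 1) && w (Fin.castAdd 6 0))))))
    (B : (Fin 6 → Bool) → (Fin 6 → Bool) → Bool)
    (hB : ∀ (t : Fin 3 → Bool) (v w x : Fin 6 → Bool),
      let Qt : (Fin 6 → Bool) → Bool := fun s =>
        f (Fin.append t s) ^^ (((Fin.append t s) (Fin.castAdd 6 0) && (Fin.append t s) (Fin.castAdd 6 1)) && (Fin.append t s) (Fin.castAdd 6 2))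
      ((Qt x ^^ Qt (bxor x w)) ^^ (Qt (bxor x v) ^^ Qt (bxor (bxor x v) w))) = B v w)
    (h : ℕ) (b c : Fin h → (Fin 6 → Bool))
    (hbc : ∀ i, B (b i) (c i) = true) (hbc' : ∀ i j, i ≠ j → B (b i) (c j) = false) (hbb : ∀ i j, B (b i) (b j) = false)
    (hmax : ∀ x y, (∀ i, B x (b i) = false) → (∀ i, B x (c i) = false) → (∀ i, B y (b i) = false) → (∀ i, B y (c i) = false) →
      B x y = false) :
    (2 ≤ h → 192 ≤ #(univ.filter fun y : Fin (3 + 6) → Bool => f y = true)) ∧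
    (1 ≤ h → 128 ≤ #(univ.filter fun y : Fin (3 + 6) → Bool => f y = true)) := by
  classical
  obtain ⟨-, hfib⟩ := tfb_fibre_formula f hT
  set Q : (Fin (3 + 6) → Bool) → Bool := fun z => f z ^^ ((z (Fin.castAdd 6 0) && z (Fin.castAdd 6 1)) && z (Fin.castAdd 6 2)) with hQ
  -- Dickson, exact, on every fibre
  have hD : ∀ t : Fin 3 → Bool, h ≤ 6 ∧
      (2 * #(univ.filter fun s : Fin 6 → Bool => Q (Fin.append t s) = true) + 2 ^ (6 - h) = 2 ^ 6 ∨
        2 * #(univ.filter fun s : Fin 6 → Bool => Q (Fin.append t s) = true) = 2 ^ 6 ∨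
        2 * #(univ.filter fun s : Fin 6 → Bool => Q (Fin.append t s) = true) = 2 ^ 6 + 2 ^ (6 - h)) :=
    fun t => tce_dickson_exact (fun s => Q (Fin.append t s)) B (fun v w x => hB t v w x) h b c hbc hbc' hbb hmax
  have hfib' : #(univ.filter fun y : Fin (3 + 6) → Bool => f y = true) + #(univ.filter fun s : Fin 6 → Bool => Q (Fin.append allOnes s) = true) =
      (∑ v ∈ (univ : Finset (Fin 3 → Bool)).erase allOnes, #(univ.filter fun s : Fin 6 → Bool => Q (Fin.append v s) = true)) + 2 ^ 6 := hfib
  have hcard7 : #((univ : Finset (Fin 3 → Bool)).erase allOnes) = 7 := by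
    rw [card_erase_of_mem (mem_univ _), card_univ, Fintype.card_fun, Fintype.card_bool, Fintype.card_fin]; rfl
  -- lower bounds on the fibre sum
  have hsum_ge : ∀ L : ℕ, (∀ t, L ≤ #(univ.filter fun s : Fin 6 → Bool => Q (Fin.append t s) = true)) →
      7 * L ≤ ∑ v ∈ (univ : Finset (Fin 3 → Bool)).erase allOnes, #(univ.filter fun s : Fin 6 → Bool => Q (Fin.append v s) = true) := by
    intro L hL
    have e := Finset.card_nsmul_le_sum ((univ : Finset (Fin 3 → Bool)).erase allOnes)
      (fun v => #(univ.filter fun s : Fin 6 → Bool => Q (Fin.append v s) = true)) L (fun v _ => hL v)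
    rw [hcard7, smul_eq_mul] at e
    exact e
  refine ⟨fun h2 => ?_, fun h1 => ?_⟩
  · -- `h ≥ 2`: every fibre has `≥ 24` ones and `#Q_111 ≤ 40`
    have hle6 := (hD allOnes).1
    have hpow : 2 ^ (6 - h) ≤ 16 := by
      have : 2 ^ (6 - h) ≤ 2 ^ 4 := Nat.pow_le_pow_right (by norm_num) (by omega)
      simpa using this
    have hpos : 1 ≤ 2 ^ (6 - h) := Nat.one_le_two_pow
    generalize hP : 2 ^ (6 - h) = P at hD hpow hpos
    have hL : ∀ t, 24 ≤ #(univ.filter fun s : Fin 6 → Bool => Q (Fin.append t s) = true) := by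
      intro t; rcases (hD t).2 with e | e | e <;> simp only [Nat.reducePow] at e <;> omega
    have h111 : #(univ.filter fun s : Fin 6 → Bool => Q (Fin.append allOnes s) = true) ≤ 40 := by
      rcases (hD allOnes).2 with e | e | e <;> simp only [Nat.reducePow] at e <;> omega
    have := hsum_ge 24 hL
    simp only [Nat.reducePow] at hfib'
    omega
  · have hle6 := (hD allOnes).1
    have hpow : 2 ^ (6 - h) ≤ 32 := by
      have : 2 ^ (6 - h) ≤ 2 ^ 5 := Nat.pow_le_pow_right (by norm_num) (by omega)
      simpa using this
    have hpos : 1 ≤ 2 ^ (6 - h) := Nat.one_le_two_pow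
    generalize hP : 2 ^ (6 - h) = P at hD hpow hpos
    have hL : ∀ t, 16 ≤ #(univ.filter fun s : Fin 6 → Bool => Q (Fin.append t s) = true) := by
      intro t; rcases (hD t).2 with e | e | e <;> simp only [Nat.reducePow] at e <;> omega
    have h111 : #(univ.filter fun s : Fin 6 → Bool => Q (Fin.append allOnes s) = true) ≤ 48 := by
      rcases (hD allOnes).2 with e | e | e <;> simp only [Nat.reducePow] at e <;> omega
    have := hsum_ge 16 hL
    simp only [Nat.reducePow] at hfib'
    omega

end Summit.QuantumAdvantage.QuantumAdvantage.Theorems.CubicForrelation.NearExactIsExact
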